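import Literature.AnabelianGeometry.EtaleTheta.MuTwoSettingPiCData
import Literature.AnabelianGeometry.EtaleTheta.Discharge.Sec2PiCTemperedSide
import Literature.AnabelianGeometry.EtaleTheta.SingleUnderline
import Literature.AnabelianGeometry.EtaleTheta.Discharge.Sec2CompletionNormal
import Literature.AnabelianGeometry.SemiGraphs.ApproximatorBridge
import Mathlib.Topology.Instances.ZMod
import HarnessLib

/-!
# [EtTh] Def. 2.1 at the §1 model: the profinite `Π_X̲ ⊆ Π_X ⊆ Π_C`, its quotient `Q ≅ ℤ/lℤ`, and an
# inversion (proof-only; W3-L2-02, the type-`(1, l-tors)±` datum feeding `TemperedCoverData.PiCuu`)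

Mochizuki, *The étale theta function and its Frobenioid-theoretic manifestations*, Publ. RIMS **45**
(2009), §2, Def. 2.1 p. 36 (printed 262): "let `Π̄^ell_X ↠ Q` be a quotient onto a free `(ℤ/lℤ)`-module
of rank `1` such that the restricted map `Δ̄^ell_X → Q` is still surjective, but the restricted map
`D_x → Q` is trivial … `X̲^log → X^log` … `ι̲` … `C̲^log`", with Def. 2.5 (i) p. 39: the quotient "factors
through the natural quotient `Π^tp_X ↠ Z`" [cite: MochizukiEtTh2009, Def 2.1 p.36].

Cell abc-iut, layer L2, W3-L2-02 (seat abc-iut-L2-d3), PROOF-ONLY (no `def`). For `M : MuTwoSetting p`,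
`e : M.CLevelData`, a profinite completion `ιC : Π^tp_C → P_C` and the `PiCData`
`I := e.piCDataOf ιC hιC` (`MuTwoSettingPiCData`: `I.incl = Φ : Π_X ↪ P_C`, `I.aug`), write
`Π_X̲ := cl(ιC(inclX(Π^tp_X̲)))` with abc-iut-L2-t8's `Π^tp_X̲ = GtpXu l = toZ⁻¹(l·Z)` (SingleUnderline).
PROVED here, in the vocabulary of abc-iut-L2-t10's `PiCData` (`I.PiX`, `I.augGK`, `I.barTheta l`, `I.Dx x`),
i.e. exactly the fields of abc-iut-L2-t2's `CoverData.IsTypeLTors` / `IsTypeLTorsPm` / `IsInversion` for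
the cover `I.coverDataAx …` (ThetaCoversAxOfSetting):

* `exists_hatToQ` — the profinite `Π_X ↠ Q`: `ψ̂ : Π_X → ℤ/lℤ` extending t8's `toQ l` (L3 `exists_extension`);
* `closureXu_le_PiX`, `index_closureXu`, `closureXu_normal` (from the TEMPERED normality
  `inclX(Π^tp_X̲) ⊴ Π^tp_C`, hypothesis `hN` — abc-iut-L6-t19's `map_inclX_GtpXu_normal`, mod L02);
* `map_ker_hatToQ_eq_closureXu` — `Φ(Ker ψ̂) = Π_X̲`; `exists_quot_closureXu` — the field `IsTypeLTors.quot`: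
  a surjection `Π_X ↠ ℤ/lℤ` with kernel `Π_X̲`;
* `barTheta_le_closureXu` (`Δ̄_Θ`-preimage `≤ Π_X̲`: `ψ̂` kills commutators and `l`-th powers),
  `Dx_le_closureXu` ("`D_x → Q` is trivial": `D_x ≤ Π^tp_Y`, abc-iut-L2-t7's `decomp_le_ker_toZ`),
  `closureXu_sup_deltaX` ("`Δ̄^ell_X → Q` is still surjective": `toZ|_Δ` onto);
* `exists_mem_ker_augGK_not_mem_PiX` — an element of `Δ_C ∖ Π_X` exists; `sq_mem_closureXu_of_inv_ell` —
  granted abc-iut-L2-t10's binder `hιell` ("`ι` acts by `−1` on `Δ̄^ell_X`", Prop. 2.2 (i)) ITS SQUARE LIES IN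
  `Π_X̲` (`2·ψ̂(c²) = 0`, `l` odd); `closureXu_sup_zpowers_inf_PiX`, `relIndex_closureXu_sup_zpowers` —
  `Π_C̲ := Π_X̲·⟨c⟩` has `Π_C̲ ∩ Π_X = Π_X̲` of index `2`.

Nothing here asserts that a `MuTwoSetting` exists; no side is taken on [IUTchIII] Cor. 3.12; typed ≠ proved.
-/

noncomputable section

namespace Literature.AnabelianGeometry.EtaleTheta

open Literature.AnabelianGeometry.SemiGraphs
open _root_.Topology

namespace MuTwoSetting.CLevelData

variable {p : ℕ} [Fact p.Prime] {M : MuTwoSetting p}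
variable {PC : Type} [Group PC] [TopologicalSpace PC] [IsTopologicalGroup PC] [T2Space PC]

/-! ### The profinite quotient `ψ̂ : Π_X → ℤ/lℤ` -/

/-- `toQ l : Π^tp_X → ℤ/lℤ` is continuous (its kernel `Π^tp_X̲` is open). [cite: MochizukiEtTh2009, Def 2.1 p.36] -/
theorem continuous_toQ (M : MuTwoSetting p) (l : ℕ) : Continuous (M.toQ l) :=
  continuous_of_isOpen_ker_of_discreteTopology (M.toQ l)
    (by rw [M.ker_toQ l]; exact M.isOpen_GtpXu l)

/-- **The profinite `Π_X ↠ Q ≅ ℤ/lℤ`**: `toQ l` extends along `toHat : Π^tp_X → Π_X` to a continuous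
`ψ̂ : Π_X → ℤ/lℤ` (`l ≠ 0`; universal property of the profinite completion).
[cite: MochizukiEtTh2009, Def 2.1 p.36] -/
theorem exists_hatToQ (M : MuTwoSetting p) (l : ℕ) [NeZero l] :
    ∃ ψ : M.PiHat →ₜ* Multiplicative (ZMod l), ∀ x : M.PiTemp, ψ (M.toHat x) = M.toQ l x :=
  IsProfiniteCompletion.exists_extension M.isProfiniteCompletion_toHat ⟨M.toQ l, continuous_toQ M l⟩

/-- `ψ̂` is onto (`toQ l` is). [cite: MochizukiEtTh2009, Def 2.1 p.36] -/
theorem hatToQ_surjective {l : ℕ} [NeZero l] (ψ : M.PiHat →ₜ* Multiplicative (ZMod l))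
    (hψ : ∀ x : M.PiTemp, ψ (M.toHat x) = M.toQ l x) : Function.Surjective ψ := fun q => by
  obtain ⟨x, hx⟩ := M.toQ_surjective l q
  exact ⟨M.toHat x, by rw [hψ, hx]⟩

/-- `Ker ψ̂` has index `l` in `Π_X`. [cite: MochizukiEtTh2009, Def 2.1 p.36] -/
theorem index_ker_hatToQ {l : ℕ} [NeZero l] (ψ : M.PiHat →ₜ* Multiplicative (ZMod l))
    (hψ : ∀ x : M.PiTemp, ψ (M.toHat x) = M.toQ l x) : ψ.toMonoidHom.ker.index = l := by
  rw [Subgroup.index_ker, MonoidHom.range_eq_top.2 (hatToQ_surjective ψ hψ), Subgroup.card_top,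
    Nat.card_eq_fintype_card, Fintype.card_multiplicative, ZMod.card]

/-! ### `Π_X̲ := cl(ιC(inclX(Π^tp_X̲)))` -/

/-- `Π_X̲ ≤ Π_X` (`Π^tp_X̲ ≤ Π^tp_X`). [cite: MochizukiEtTh2009, Def 2.1 p.36] -/
theorem closureXu_le_PiX (e : M.CLevelData) (ιC : M.GtpC →ₜ* PC) (hιC : IsProfiniteCompletion ιC) (l : ℕ) :
    (((M.GtpXu l).map M.inclX).map ιC.toMonoidHom).topologicalClosure ≤ (e.piCDataOf ιC hιC).PiX :=
  closure_map_inclX_le_range ιC hιC _ (e.piCDataOf_incl_toHat ιC hιC) _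

omit [T2Space PC] in
/-- **`[P_C : Π_X̲] = 2·l`** (`[Π^tp_X : Π^tp_X̲] = l`, abc-iut-L2-t8 `index_GtpXu`; `[Π_C : Π_X] = 2`).
[cite: MochizukiEtTh2009, Rmk 2.3.1 p.38] -/
theorem index_closureXu (e : M.CLevelData) (ιC : M.GtpC →ₜ* PC) (hιC : IsProfiniteCompletion ιC) {l : ℕ}
    (hl : l ≠ 0) : ((((M.GtpXu l).map M.inclX).map ιC.toMonoidHom).topologicalClosure).index = 2 * l := by
  haveI : (M.GtpXu l).FiniteIndex := ⟨by rw [M.index_GtpXu l]; exact hl⟩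
  rw [e.index_closure_map_inclX ιC hιC _ (M.isOpen_GtpXu l), M.index_GtpXu l]

omit [T2Space PC] in
/-- `Π_X̲` is open in `P_C`. [cite: MochizukiEtTh2009, Def 2.1 p.36] -/
theorem isOpen_closureXu (e : M.CLevelData) (ιC : M.GtpC →ₜ* PC) (hιC : IsProfiniteCompletion ιC) {l : ℕ}
    (hl : l ≠ 0) : IsOpen (((((M.GtpXu l).map M.inclX).map ιC.toMonoidHom).topologicalClosure :
      Subgroup PC) : Set PC) := by
  haveI : (M.GtpXu l).FiniteIndex := ⟨by rw [M.index_GtpXu l]; exact hl⟩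
  exact e.isOpen_closure_map_inclX ιC hιC _ (M.isOpen_GtpXu l)

omit [T2Space PC] in
/-- **`Π_X̲ ⊴ P_C`** from the TEMPERED normality `inclX(Π^tp_X̲) ⊴ Π^tp_C` (hypothesis `hN`: abc-iut-L6-t19's
`map_inclX_GtpXu_normal`, which rests on the printed definition of `Z`, L02): the closure of the image of a
normal subgroup under the dense `ιC` is normal. [cite: MochizukiEtTh2009, Rmk 2.1.1 p.36] -/
theorem closureXu_normal (ιC : M.GtpC →ₜ* PC) (hιC : IsProfiniteCompletion ιC) (l : ℕ)
    (hN : ((M.GtpXu l).map M.inclX).Normal) :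
    ((((M.GtpXu l).map M.inclX).map ιC.toMonoidHom).topologicalClosure).Normal := by
  have htop : ((⊤ : Subgroup M.GtpC).map ιC.toMonoidHom).topologicalClosure = ⊤ := by
    rw [eq_top_iff]
    intro z _
    change z ∈ closure (((⊤ : Subgroup M.GtpC).map ιC.toMonoidHom : Subgroup PC) : Set PC)
    rw [Subgroup.coe_map, Subgroup.coe_top, Set.image_univ]
    have hz : z ∈ closure (Set.range ιC) := by rw [hιC.denseRange.closure_range]; trivial
    exact hz
  have hN' : (((M.GtpXu l).map M.inclX).subgroupOf (⊤ : Subgroup M.GtpC)).Normal := inferInstance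
  have h := Subgroup.normal_subgroupOf_topologicalClosure_map ιC.toMonoidHom
    (le_top : (M.GtpXu l).map M.inclX ≤ ⊤) hN'
  rw [htop] at h
  exact Subgroup.normalizer_eq_top_iff.mp
    (top_le_iff.mp ((Subgroup.normal_subgroupOf_iff_le_normalizer le_top).mp h))

/-- **`Φ(Ker ψ̂) = Π_X̲`**: both have index `2l` in `P_C`, and `Π_X̲ ≤ Φ(Ker ψ̂)` (`ψ̂(toHat u) = toQ u = 1`
for `u ∈ Π^tp_X̲`, `Φ(Ker ψ̂)` is closed). [cite: MochizukiEtTh2009, Def 2.1 p.36] -/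
theorem map_ker_hatToQ_eq_closureXu (e : M.CLevelData) (ιC : M.GtpC →ₜ* PC) (hιC : IsProfiniteCompletion ιC)
    {l : ℕ} [NeZero l] (ψ : M.PiHat →ₜ* Multiplicative (ZMod l))
    (hψ : ∀ x : M.PiTemp, ψ (M.toHat x) = M.toQ l x) :
    ψ.toMonoidHom.ker.map (e.piCDataOf ιC hιC).incl.toMonoidHom =
      (((M.GtpXu l).map M.inclX).map ιC.toMonoidHom).topologicalClosure := by
  haveI : CompactSpace M.PiHat := M.isProfiniteCompletion_toHat.compactSpace
  set I := e.piCDataOf ιC hιC with hI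
  set H := (((M.GtpXu l).map M.inclX).map ιC.toMonoidHom).topologicalClosure with hH
  -- `H ≤ Φ(Ker ψ̂)`
  have hclosed : IsClosed ((ψ.toMonoidHom.ker.map I.incl.toMonoidHom : Subgroup PC) : Set PC) := by
    rw [Subgroup.coe_map]
    exact I.isClosedEmbedding_incl.isClosedMap _
      ((isClosed_singleton (x := (1 : Multiplicative (ZMod l)))).preimage ψ.continuous)
  have hle : H ≤ ψ.toMonoidHom.ker.map I.incl.toMonoidHom := by
    refine Subgroup.topologicalClosure_minimal _ ?_ hclosed
    rintro _ ⟨_, ⟨u, hu, rfl⟩, rfl⟩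
    refine ⟨M.toHat u, ?_, ?_⟩
    · show ψ (M.toHat u) = 1
      rw [hψ, ← MonoidHom.mem_ker, M.ker_toQ]
      exact hu
    · exact (e.piCDataOf_incl_toHat ιC hιC u)
  -- equal indices
  have hidx : (ψ.toMonoidHom.ker.map I.incl.toMonoidHom).index = 2 * l := by
    rw [Subgroup.index_map, (MonoidHom.ker_eq_bot_iff _).2 I.incl_injective, sup_bot_eq,
      index_ker_hatToQ ψ hψ, I.index_range, mul_comm]
  symm
  refine le_antisymm hle ?_
  have hrel := Subgroup.relIndex_mul_index hle
  rw [hidx, e.index_closureXu ιC hιC (NeZero.ne l)] at hrel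
  have h1 : H.relIndex (ψ.toMonoidHom.ker.map I.incl.toMonoidHom) = 1 :=
    mul_right_cancel₀ (mul_ne_zero two_ne_zero (NeZero.ne l)) (by rw [hrel, one_mul])
  exact Subgroup.relIndex_eq_one.mp h1

/-- **`IsTypeLTors.quot` at the model**: a surjection `Π_X ↠ ℤ/lℤ` whose kernel is `Π_X̲` — the transport
of `ψ̂` along `Φ : Π̂_X ⥲ Π_X ⊆ P_C`. [cite: MochizukiEtTh2009, Def 2.1 p.36] -/
theorem exists_quot_closureXu (e : M.CLevelData) (ιC : M.GtpC →ₜ* PC) (hιC : IsProfiniteCompletion ιC)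
    (l : ℕ) [NeZero l] :
    ∃ φ : ↥(e.piCDataOf ιC hιC).PiX →* Multiplicative (ZMod l), Function.Surjective φ ∧
      ∀ g : ↥(e.piCDataOf ιC hιC).PiX, φ g = 1 ↔
        (g : PC) ∈ (((M.GtpXu l).map M.inclX).map ιC.toMonoidHom).topologicalClosure := by
  set I := e.piCDataOf ιC hιC with hI
  obtain ⟨ψ, hψ⟩ := exists_hatToQ M l
  let ρ : ↥I.PiX ≃* M.PiHat := (MonoidHom.ofInjective (f := I.incl.toMonoidHom) I.incl_injective).symm
  have hρ : ∀ g : ↥I.PiX, I.incl (ρ g) = (g : PC) := fun g =>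
    MonoidHom.apply_ofInjective_symm (f := I.incl.toMonoidHom) I.incl_injective g
  refine ⟨ψ.toMonoidHom.comp ρ.toMonoidHom, (hatToQ_surjective ψ hψ).comp ρ.surjective, fun g => ?_⟩
  rw [← e.map_ker_hatToQ_eq_closureXu ιC hιC ψ hψ]
  change ψ (ρ g) = 1 ↔ _
  constructor
  · intro h
    exact ⟨ρ g, h, hρ g⟩
  · rintro ⟨z, hz, hzg⟩
    have : ρ g = z := I.incl_injective (by rw [hρ]; exact hzg.symm)
    rw [this]
    exact hz

/-! ### `Δ̄_Θ`-preimage, `D_x`, `Δ_X` against `Π_X̲` -/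

/-- `ψ̂` kills `barThetaHat l = cl([Δ_X,Δ_X]·Δ_X^l)` (abelian target of exponent `l`, closed kernel).
[cite: MochizukiEtTh2009, Def 2.1 p.35] -/
theorem barThetaHat_le_ker_hatToQ {l : ℕ} [NeZero l] (ψ : M.PiHat →ₜ* Multiplicative (ZMod l)) :
    M.barThetaHat l ≤ ψ.toMonoidHom.ker := by
  have hclosed : IsClosed ((ψ.toMonoidHom.ker : Subgroup M.PiHat) : Set M.PiHat) :=
    (isClosed_singleton (x := (1 : Multiplicative (ZMod l)))).preimage ψ.continuous
  refine Subgroup.topologicalClosure_minimal _ (sup_le ?_ ?_) hclosed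
  · rw [Subgroup.commutator_def]
    refine Subgroup.closure_le _ |>.2 ?_
    rintro _ ⟨a, -, b, -, rfl⟩
    rw [SetLike.mem_coe, MonoidHom.mem_ker, commutatorElement_def, map_mul, map_mul, map_mul, map_inv,
      map_inv, mul_inv_cancel_comm, mul_inv_cancel]
  · refine Subgroup.normalClosure_le_normal ?_
    rintro _ ⟨y, -, rfl⟩
    rw [SetLike.mem_coe, MonoidHom.mem_ker, map_pow]
    apply Multiplicative.toAdd.injective
    rw [toAdd_pow, toAdd_one, nsmul_eq_mul, ZMod.natCast_self, zero_mul]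

/-- **`Δ̄_Θ`-preimage `≤ Π_X̲`** (field `IsTypeLTors.barTheta_le`: "the quotient factors through `Π̄^ell_X`").
[cite: MochizukiEtTh2009, Def 2.1 p.36] -/
theorem barTheta_le_closureXu (e : M.CLevelData) (ιC : M.GtpC →ₜ* PC) (hιC : IsProfiniteCompletion ιC)
    (op : M.toThetaSetting.OncePuncturedData) (l : ℕ) [NeZero l] :
    (e.piCDataOf ιC hιC).barTheta l ≤ (((M.GtpXu l).map M.inclX).map ιC.toMonoidHom).topologicalClosure := by
  obtain ⟨ψ, hψ⟩ := exists_hatToQ M l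
  rw [(e.piCDataOf ιC hιC).barTheta_eq_map l op, ← e.map_ker_hatToQ_eq_closureXu ιC hιC ψ hψ]
  exact Subgroup.map_mono (barThetaHat_le_ker_hatToQ ψ)

/-- **`D_x ≤ Π_X̲`** for a cusp `x` (field `IsTypeLTors.Dx_le`: "the restricted map `D_x → Q` is trivial";
here from `D_x ≤ Π^tp_Y = Ker toZ`, abc-iut-L2-t7's `decomp_le_ker_toZ`). [cite: MochizukiEtTh2009, Def 2.1 p.36] -/
theorem Dx_le_closureXu (e : M.CLevelData) (ιC : M.GtpC →ₜ* PC) (hιC : IsProfiniteCompletion ιC)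
    (op : M.toThetaSetting.OncePuncturedData) (l : ℕ) [NeZero l] {x : M.Pt} (hx : M.IsCusp x) :
    (e.piCDataOf ιC hιC).Dx x ≤ (((M.GtpXu l).map M.inclX).map ιC.toMonoidHom).topologicalClosure := by
  obtain ⟨ψ, hψ⟩ := exists_hatToQ M l
  rw [← e.map_ker_hatToQ_eq_closureXu ιC hιC ψ hψ]
  refine Subgroup.map_mono (Subgroup.topologicalClosure_minimal _ ?_
    ((isClosed_singleton (x := (1 : Multiplicative (ZMod l)))).preimage ψ.continuous))
  rintro _ ⟨g, hg, rfl⟩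
  rw [MonoidHom.mem_ker]
  change ψ (M.toHat g) = 1
  rw [hψ, ← MonoidHom.mem_ker, M.ker_toQ]
  exact M.GtpY_le_GtpXu l (op.decomp_le_ker_toZ x hx hg)

/-- **`Π_X̲ · Δ_X = Π_X`** (field `IsTypeLTors.delta_sup`: "the restricted map `Δ̄^ell_X → Q` is still
surjective"; from `Δ^tp_X · Π^tp_X̲ = Π^tp_X`, abc-iut-L2-t8's `deltaTemp_sup_GtpXu`, i.e. `toZ|_Δ` onto).
[cite: MochizukiEtTh2009, Def 2.1 p.36] -/
theorem closureXu_sup_deltaX (e : M.CLevelData) (ιC : M.GtpC →ₜ* PC) (hιC : IsProfiniteCompletion ιC)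
    (l : ℕ) [NeZero l] :
    (((M.GtpXu l).map M.inclX).map ιC.toMonoidHom).topologicalClosure ⊔
        ((e.piCDataOf ιC hιC).PiX ⊓ (e.piCDataOf ιC hιC).augGK.ker) = (e.piCDataOf ιC hιC).PiX := by
  set I := e.piCDataOf ιC hιC with hI
  obtain ⟨ψ, hψ⟩ := exists_hatToQ M l
  refine le_antisymm (sup_le (e.closureXu_le_PiX ιC hιC l) inf_le_left) ?_
  rintro _ ⟨z, rfl⟩
  -- `ψ̂ z = toQ d` for some `d ∈ Δ^tp_X`
  obtain ⟨⟨d, hd⟩, hdq⟩ : ∃ d : ↥M.DeltaTemp, M.toQ l d = ψ z := by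
    obtain ⟨y, hy⟩ := M.toQ_surjective l (ψ z)
    have hy' : y ∈ M.DeltaTemp ⊔ M.GtpXu l := by rw [M.deltaTemp_sup_GtpXu l]; trivial
    obtain ⟨d, hd, u, hu, rfl⟩ := Subgroup.mem_sup_of_normal_right.mp hy'
    refine ⟨⟨d, hd⟩, ?_⟩
    rw [← M.ker_toQ l, MonoidHom.mem_ker] at hu
    rw [← hy, map_mul, hu, mul_one]
  have hsplit : (I.incl z : PC) = I.incl (z * (M.toHat d)⁻¹) * I.incl (M.toHat d) := by
    rw [← map_mul, inv_mul_cancel_right]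
  rw [show I.incl.toMonoidHom z = I.incl z from rfl, hsplit]
  refine Subgroup.mul_mem _ (Subgroup.mem_sup_left ?_) (Subgroup.mem_sup_right ⟨⟨M.toHat d, rfl⟩, ?_⟩)
  · rw [← e.map_ker_hatToQ_eq_closureXu ιC hιC ψ hψ]
    refine ⟨_, ?_, rfl⟩
    show ψ (z * (M.toHat d)⁻¹) = 1
    rw [map_mul, map_inv, hψ, hdq, mul_inv_cancel]
  · show I.incl (M.toHat d) ∈ I.augGK.ker
    rw [I.mem_ker_augGK, I.aug_incl, M.augHat_comp]
    exact hd

/-! ### An inversion and `Π_C̲ := Π_X̲·⟨ι⟩` -/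

/-- **An element of `Δ_C ∖ Π_X` exists** (`[Π_C : Π_X] = 2`, `Π_X ↠ G_K`): a lift of the non-trivial element
of `Gal(X/C)` corrected into `Δ_C`. [cite: MochizukiEtTh2009, Def 2.1 p.36] -/
theorem exists_mem_ker_augGK_not_mem_PiX {D : ThetaSetting p} (I : D.PiCData PC) :
    ∃ c : PC, c ∈ I.augGK.ker ∧ c ∉ I.PiX := by
  have hne : I.PiX ≠ ⊤ := fun htop => by
    have := I.index_range
    rw [show I.incl.toMonoidHom.range = I.PiX from rfl, htop, Subgroup.index_top] at this
    exact absurd this (by norm_num)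
  obtain ⟨c₀, -, hc₀⟩ := SetLike.exists_of_lt hne.lt_top
  obtain ⟨⟨x, hx⟩, hxa⟩ := I.augGK_PiX_surjective (I.augGK c₀)
  refine ⟨c₀ * x⁻¹, ?_, fun h => hc₀ ?_⟩
  · rw [MonoidHom.mem_ker, map_mul, map_inv, mul_inv_eq_one]
    exact hxa.symm
  · have := Subgroup.mul_mem _ h hx
    rwa [inv_mul_cancel_right] at this

/-- **Granted `hιell` (abc-iut-L2-t10's binder: `ι` acts by `−1` on `Δ̄^ell_X`, Prop. 2.2 (i)), the square
of ANY `c ∈ Δ_C ∖ Π_X` lies in `Π_X̲`**: `c² ∈ Δ_X`, and `c·c²·c⁻¹·c² = c⁴ ∈ Δ̄_Θ`-preimage `≤ Π_X̲` gives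
`2·ψ̂(c²) = 0` in `ℤ/lℤ`, whence `ψ̂(c²) = 0` as `l` is odd. [cite: MochizukiEtTh2009, Prop 2.2(iii) p.37] -/
theorem sq_mem_closureXu_of_inv_ell (e : M.CLevelData) (ιC : M.GtpC →ₜ* PC) (hιC : IsProfiniteCompletion ιC)
    (op : M.toThetaSetting.OncePuncturedData) {l : ℕ} (hodd : Odd l)
    (hιell : ∀ c ∈ (e.piCDataOf ιC hιC).augGK.ker, c ∉ (e.piCDataOf ιC hιC).PiX →
      ∀ d ∈ (e.piCDataOf ιC hιC).PiX ⊓ (e.piCDataOf ιC hιC).augGK.ker,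
        c * d * c⁻¹ * d ∈ (e.piCDataOf ιC hιC).barTheta l)
    {c : PC} (hc : c ∈ (e.piCDataOf ιC hιC).augGK.ker) (hcX : c ∉ (e.piCDataOf ιC hιC).PiX) :
    c * c ∈ (((M.GtpXu l).map M.inclX).map ιC.toMonoidHom).topologicalClosure := by
  haveI : NeZero l := ⟨by obtain ⟨k, hk⟩ := hodd; omega⟩
  set I := e.piCDataOf ιC hιC with hI
  haveI := I.range_normal
  obtain ⟨φ, -, hφ⟩ := e.exists_quot_closureXu ιC hιC l
  -- `c² ∈ Π_X` (index `2`, normal) and `c² ∈ Δ_C`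
  have hc2X : c * c ∈ I.PiX := by
    have h := Subgroup.mul_self_mem_of_index_two I.index_range c
    exact h
  have hc2Δ : c * c ∈ I.PiX ⊓ I.augGK.ker := ⟨hc2X, Subgroup.mul_mem _ hc hc⟩
  -- `c⁴ ∈ barTheta ≤ Π_X̲`
  have hc4 : c * (c * c) * c⁻¹ * (c * c) ∈ (((M.GtpXu l).map M.inclX).map ιC.toMonoidHom).topologicalClosure :=
    e.barTheta_le_closureXu ιC hιC op l (hιell c hc hcX _ hc2Δ)
  have hc4' : c * (c * c) * c⁻¹ * (c * c) = (c * c) * (c * c) := by group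
  rw [hc4'] at hc4
  have h2 : φ ⟨c * c, hc2X⟩ * φ ⟨c * c, hc2X⟩ = 1 := by
    rw [← map_mul]
    exact (hφ ⟨(c * c) * (c * c), Subgroup.mul_mem _ hc2X hc2X⟩).mpr hc4
  -- `2·a = 0 ⇒ a = 0` in `ℤ/lℤ`, `l` odd
  have ha : φ ⟨c * c, hc2X⟩ = 1 := by
    set a := Multiplicative.toAdd (φ ⟨c * c, hc2X⟩) with ha
    have h2a : (2 : ZMod l) * a = 0 := by
      rw [two_mul]
      exact congrArg Multiplicative.toAdd h2
    have hu : IsUnit (2 : ZMod l) := by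
      have hcop : Nat.Coprime 2 l := Nat.Coprime.symm (Odd.coprime_two_right hodd)
      exact (ZMod.unitOfCoprime 2 hcop).isUnit
    have : a = 0 := (hu.mul_right_eq_zero).mp h2a
    exact congrArg Multiplicative.ofAdd this
  exact (hφ ⟨c * c, hc2X⟩).mp ha

/-- For `N ⊴ G` and `e ∈ G` with `e² ∈ N`: `g ∈ N ⊔ ⟨e⟩` iff `g ∈ N` or `g·e⁻¹ ∈ N` (`N ⊔ ⟨e⟩ = N ∪ N·e`;
the same folklore lemma is private in abc-iut-L2-t1's `Sec1Def17Coverings`). [cite: MochizukiEtTh2009, Def 2.1 p.36] -/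
theorem mem_sup_zpowers_iff_of_sq_mem {G : Type*} [Group G] {N : Subgroup G} [N.Normal] {e : G}
    (he : e * e ∈ N) {g : G} : g ∈ N ⊔ Subgroup.zpowers e ↔ g ∈ N ∨ g * e⁻¹ ∈ N := by
  constructor
  · intro hg
    have hg' : g ∈ ((N ⊔ Subgroup.zpowers e : Subgroup G) : Set G) := hg
    rw [Subgroup.normal_mul] at hg'
    obtain ⟨n, hn, z, hz, rfl⟩ := Set.mem_mul.mp hg'
    obtain ⟨k, rfl⟩ := Subgroup.mem_zpowers_iff.mp hz
    have he2 : e ^ (2 : ℤ) ∈ N := by rw [zpow_two]; exact he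
    rcases Int.even_or_odd k with ⟨m, rfl⟩ | ⟨m, rfl⟩
    · left
      have : e ^ (m + m) = (e ^ (2 : ℤ)) ^ m := by rw [← two_mul, zpow_mul]
      rw [this]
      exact N.mul_mem hn (N.zpow_mem he2 m)
    · right
      have : n * e ^ (2 * m + 1) * e⁻¹ = n * (e ^ (2 : ℤ)) ^ m := by
        rw [zpow_add, zpow_one, zpow_mul]; group
      rw [this]
      exact N.mul_mem hn (N.zpow_mem he2 m)
  · rintro (hg | hg)
    · exact Subgroup.mem_sup_left hg
    · have : g = g * e⁻¹ * e := by group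
      rw [this]
      exact (N ⊔ Subgroup.zpowers e).mul_mem (Subgroup.mem_sup_left hg)
        (Subgroup.mem_sup_right (Subgroup.mem_zpowers e))

/-- **`Π_C̲ ∩ Π_X = Π_X̲`** for `Π_C̲ := Π_X̲ ⊔ ⟨c⟩` with `Π_X̲ ⊴ P_C`, `c ∉ Π_X`, `c² ∈ Π_X̲`
(field `IsTypeLTorsPm.inf_isTypeLTors`, carrier part). [cite: MochizukiEtTh2009, Def 2.1 p.36] -/
theorem sup_zpowers_inf_eq_of_sq_mem {G : Type*} [Group G] {H P : Subgroup G} [H.Normal] (hHP : H ≤ P)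
    {c : G} (hc2 : c * c ∈ H) (hcP : c ∉ P) : (H ⊔ Subgroup.zpowers c) ⊓ P = H := by
  refine le_antisymm ?_ (le_inf le_sup_left hHP)
  rintro g ⟨hg, hgP⟩
  rcases (mem_sup_zpowers_iff_of_sq_mem hc2).mp hg with h | h
  · exact h
  · exfalso
    apply hcP
    have : c = (g * c⁻¹)⁻¹ * g := by group
    rw [this]
    exact P.mul_mem (P.inv_mem (hHP h)) hgP

/-- **`[Π_C̲ : Π_X̲] = 2`** for `Π_C̲ := Π_X̲ ⊔ ⟨c⟩` with `Π_X̲ ⊴`, `c ∉ Π_X̲`, `c² ∈ Π_X̲`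
(field `IsTypeLTorsPm.relIndex_two`). [cite: MochizukiEtTh2009, Def 2.1 p.36] -/
theorem relIndex_sup_zpowers_of_sq_mem {G : Type*} [Group G] {H : Subgroup G} [H.Normal] {c : G}
    (hc2 : c * c ∈ H) (hcH : c ∉ H) : H.relIndex (H ⊔ Subgroup.zpowers c) = 2 := by
  classical
  rw [Subgroup.relIndex, Subgroup.index_eq_two_iff]
  refine ⟨⟨c, Subgroup.mem_sup_right (Subgroup.mem_zpowers c)⟩, fun g => ?_⟩
  rcases (mem_sup_zpowers_iff_of_sq_mem hc2).mp g.2 with h | h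
  · -- `g ∈ H`: then `g * c ∉ H`
    refine Or.inr ⟨?_, fun hgc => hcH ?_⟩
    · rw [Subgroup.mem_subgroupOf]; exact h
    · rw [Subgroup.mem_subgroupOf] at hgc
      have : c = (g : G)⁻¹ * ((g : G) * c) := by group
      rw [this]
      exact H.mul_mem (H.inv_mem h) hgc
  · refine Or.inl ⟨?_, fun hg => hcH ?_⟩
    · rw [Subgroup.mem_subgroupOf]
      change (g : G) * c ∈ H
      have : (g : G) * c = (g * c⁻¹) * (c * c) := by group
      rw [this]
      exact H.mul_mem h hc2
    · rw [Subgroup.mem_subgroupOf] at hg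
      have : c = ((g : G) * c⁻¹)⁻¹ * g := by group
      rw [this]
      exact H.mul_mem (H.inv_mem h) hg

end MuTwoSetting.CLevelData

end Literature.AnabelianGeometry.EtaleTheta

end
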